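import Literature.Geometry.Lorentzian.OpensCausality
import Literature.Geometry.Lorentzian.CauchyDevelopmentRestrict
import Literature.Geometry.Lorentzian.CauchyDevelopmentIsometryClasses
import Summits.FinalStateConjecture.FinalStateConjecture.Theorems.SwallowTheDatumSubdataDevelopmentsEmbedRigidity

/-!
# Route SwallowTheDatum · item `SubdataDevelopmentsEmbed` (stmt-FinalStateConjecture-10053) —
# realising a common sub-development inside the first development (Sbierski 2016, §2, Remark (2))

Sbierski (Ann. Henri Poincaré 17 (2016) = arXiv:1309.7591, §2) gives two definitions of a common
globally hyperbolic development (CGHD) of two GHDs `M`, `M'` of the same data: the symmetric one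
(a GHD `U` of the same data of which both `M` and `M'` are extensions — in the tree:
`𝒰.EmbedsInto 𝒟₁ ∧ 𝒰.EmbedsInto 𝒟₂`) and the realised one (an open `U ⊆ M` with `ι(N) ⊆ U` a
Cauchy hypersurface of `(U, g|_U)` and `M'` an extension of it), and remarks (Remark (2) after
Def. 2.4): *"given any CGHD `U` of `M` and `M'` in the sense of [the symmetric definition], we can
isometrically embed `U` into `M` by using the isometric embedding that is provided by `M` being an
extension of `U`."* This file proves that remark over the prelude, in the form consumed by this
route's Zorn construction (`exists_maximal_relCGHD`, whose members are realised sub-developments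
with a map `ψ : M₁ → M₂` smooth/isometric/orientation-preserving ON `U`):

* `exists_realised_of_embedsInto` — from `𝒰 ≼ 𝒟₁` (witness `j`) and `𝒰 ≼ 𝒟₂` (witness `k`), the
  pair `(U, ψ) = (j(𝒰), k ∘ j⁻¹)`: `U` is open (open embedding), connected, contains
  `ι₁(N) = j(ι_𝒰(N))`; `j⁻¹` is smooth on `U` (`j` is a local diffeomorphism: invertible
  differential, `isLocalDiffeomorphAt_of_mfderiv`), `k ∘ j⁻¹` is isometric and time-orientation
  preserving on `U` (chain rule, `dj ∘ dj⁻¹ = id`, converse timecone lemma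
  `PreservesTimeOrientation.isFutureDirected_of_mfderiv`), `(k ∘ j⁻¹) ∘ ι₁ = k ∘ ι_𝒰 = ι₂`; and
  **`ι₁(N)` is a Cauchy hypersurface of the open sub-spacetime `U`**: an endless timelike curve of
  `U` pulls back along `j⁻¹` to an endless timelike curve of `𝒰` (isometry, converse timecone
  lemma, endpoints transported by the homeomorphism `j : 𝒰 ≅ U`), which meets `ι_𝒰(N)` exactly
  once.

So the printed local-uniqueness theorem (Sbierski 2016, Thm. 2.4 (ii); Choquet-Bruhat–Geroch 1969,
Thm. 2: any two developments of the same data have a common sub-development, symmetric form)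
feeds the realised form used by `exists_maximal_relCGHD` / the skeleton of the item. All proved;
no definitions, no named facts.
-/

noncomputable section

open Function Set Filter Topology TopologicalSpace
open scoped Manifold ContDiff Topology

namespace Summit.FinalStateConjecture.FinalStateConjecture.Theorems

namespace SubdataDevelopmentsEmbed

open Literature.Geometry.Lorentzian

universe u

variable {n : ℕ}
  {N : Type u} [TopologicalSpace N] [ChartedSpace (EuclideanSpace ℝ (Fin n)) N]
  [IsManifold (𝓡 n) ∞ N] [ConnectedSpace N] {D₁ : InitialDataSet (𝓡 n) N}

/-! ### The inverse of an embedding of developments on its range -/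

section Inverse

variable {𝒮 𝒮' : Spacetime.{u} (n + 1)} {j : 𝒮.carrier → 𝒮'.carrier}

/-- **The inverse of an isometric open embedding is smooth on its range.** For a smooth
isometric immersion `j : M → M'` (hence a local diffeomorphism: its differential is invertible,
`isInvertible_mfderiv_of_isIsometricImmersion`, inverse function theorem
`Literature.Geometry.Manifold.isLocalDiffeomorphAt_of_mfderiv`) which is injective, the inverse
`Function.invFun j` is smooth on the (open) range of `j`: near `j x` it agrees with the inverse of a
local diffeomorphism chart of `j`. [folklore] -/
theorem contMDiffOn_invFun_range
    (hj : 𝒮.metric.IsIsometricImmersion 𝒮'.metric.toPseudoRiemannianMetric j) (hinj : Injective j) :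
    ContMDiffOn (𝓡 (n + 1)) (𝓡 (n + 1)) ∞ (invFun j) (range j) := by
  haveI : Nonempty 𝒮.carrier := inferInstance
  rintro _ ⟨x, rfl⟩
  -- a local diffeomorphism chart of `j` at `x`
  obtain ⟨e, he⟩ := isInvertible_mfderiv_of_isIsometricImmersion hj x
  obtain ⟨Φ, hxΦ, heq⟩ : IsLocalDiffeomorphAt (𝓡 (n + 1)) (𝓡 (n + 1)) ∞ j x :=
    Literature.Geometry.Manifold.isLocalDiffeomorphAt_of_mfderiv (by simp) isOpen_univ (mem_univ x)
      hj.1.contMDiffOn e he.symm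
  -- `invFun j = Φ⁻¹` on the open set `Φ.target ∋ j x`
  have hjx : j x ∈ Φ.target := by rw [heq hxΦ]; exact Φ.map_source hxΦ
  have hev : invFun j =ᶠ[𝓝 (j x)] Φ.symm := by
    filter_upwards [Φ.open_target.mem_nhds hjx] with y hy
    have h1 : j (Φ.symm y) = y := (heq (Φ.map_target hy)).trans (Φ.right_inv hy)
    calc invFun j y = invFun j (j (Φ.symm y)) := by rw [h1]
      _ = Φ.symm y := leftInverse_invFun hinj _
  have hsymm : ContMDiffAt (𝓡 (n + 1)) (𝓡 (n + 1)) ∞ Φ.symm (j x) :=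
    (Φ.contMDiffOn_invFun (j x) hjx).contMDiffAt (Φ.open_target.mem_nhds hjx)
  exact (hsymm.congr_of_eventuallyEq hev).contMDiffWithinAt

/-- `j⁻¹ ∘ j = id` and `j ∘ j⁻¹ = id` on the range, at the level of differentials:
`dj_x (d(j⁻¹)_{j x} w) = w` for every `w`. [folklore] -/
theorem mfderiv_comp_mfderiv_invFun
    (hj : 𝒮.metric.IsIsometricImmersion 𝒮'.metric.toPseudoRiemannianMetric j) (hinj : Injective j)
    (ho : IsOpenEmbedding j) (x : 𝒮.carrier) (w : TangentSpace (𝓡 (n + 1)) (j x)) :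
    mfderiv (𝓡 (n + 1)) (𝓡 (n + 1)) j (invFun j (j x))
      (mfderiv (𝓡 (n + 1)) (𝓡 (n + 1)) (invFun j) (j x) w) = w := by
  haveI : Nonempty 𝒮.carrier := inferInstance
  have hjd : MDifferentiable (𝓡 (n + 1)) (𝓡 (n + 1)) j := hj.1.mdifferentiable (by simp)
  have hid : MDifferentiableAt (𝓡 (n + 1)) (𝓡 (n + 1)) (invFun j) (j x) :=
    ((contMDiffOn_invFun_range hj hinj (j x) ⟨x, rfl⟩).contMDiffAt
      (ho.isOpen_range.mem_nhds ⟨x, rfl⟩)).mdifferentiableAt (by simp)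
  -- `j ∘ j⁻¹ = id` near `j x`
  have hev : (j ∘ invFun j) =ᶠ[𝓝 (j x)] id := by
    filter_upwards [ho.isOpen_range.mem_nhds ⟨x, rfl⟩] with y hy
    exact invFun_eq hy
  have h := mfderiv_comp (j x) (hjd (invFun j (j x))) hid
  have h2 : mfderiv (𝓡 (n + 1)) (𝓡 (n + 1)) (j ∘ invFun j) (j x) =
      ContinuousLinearMap.id ℝ (TangentSpace (𝓡 (n + 1)) (j x)) := by
    rw [hev.mfderiv_eq, mfderiv_id]
  rw [h2] at h
  exact (congrArg (fun L ↦ L w) h).symm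

end Inverse

/-! ### Realising a common sub-development inside the first development -/

/-- **A common sub-development of two Cauchy developments of the same data is realised inside the
first one** (Sbierski 2016, §2, Remark (2) after Def. 2.4: "we can isometrically embed `U` into `M`
by using the isometric embedding that is provided by `M` being an extension of `U`"). If `𝒰`
embeds into `𝒟₁` (by `j`) and into `𝒟₂` (by `k`), then `U = j(𝒰) ⊆ M₁` is open and connected,
contains `ι₁(N)`, `ι₁(N)` is a Cauchy hypersurface of the open sub-spacetime `U` (endless timelike
curves of `U` pull back along the isometry `j⁻¹ : U → 𝒰` to endless timelike curves of `𝒰`), and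
`ψ = k ∘ j⁻¹ : M₁ → M₂` is smooth, isometric and time-orientation preserving on `U` with
`ψ ∘ ι₁ = ι₂`. [cite: Sbierski2016AHP, §2, Def. 2.4 and Remark (2)] -/
theorem exists_realised_of_embedsInto (𝒟₁ 𝒟₂ 𝒰 : CauchyDevelopment D₁)
    (h₁ : 𝒰.EmbedsInto 𝒟₁) (h₂ : 𝒰.EmbedsInto 𝒟₂) :
    ∃ (U : Opens 𝒟₁.carrier) (ψ : 𝒟₁.carrier → 𝒟₂.carrier),
      (∀ u, 𝒟₁.embed u ∈ U) ∧ IsConnected (U : Set 𝒟₁.carrier) ∧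
      (𝒟₁.metric.restrict PseudoRiemannianMetric.contMDiff_restrict_holds U).IsCauchyHypersurface
        (𝒟₁.timeOrientation.restrict PseudoRiemannianMetric.contMDiff_restrict_holds
          𝒟₁.timeOrientation.contMDiff_restrict_holds U) (Subtype.val ⁻¹' range 𝒟₁.embed) ∧
      ContMDiffOn (𝓡 (n + 1)) (𝓡 (n + 1)) ∞ ψ U ∧
      (∀ p ∈ U, pullbackBilin (I := 𝓡 (n + 1)) (I' := 𝓡 (n + 1)) ψ 𝒟₂.metric.val p =
        𝒟₁.metric.val p) ∧
      (∀ p ∈ U, 𝒟₂.timeOrientation.IsFutureDirected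
        (mfderiv (𝓡 (n + 1)) (𝓡 (n + 1)) ψ p (𝒟₁.timeOrientation.vectorField p))) ∧
      ψ ∘ 𝒟₁.embed = 𝒟₂.embed := by
  classical
  haveI : Nonempty 𝒰.carrier := inferInstance
  obtain ⟨j, hjs, hjo, hji, hjt, hjc⟩ := h₁
  obtain ⟨k, hks, hko, hki, hkt, hkc⟩ := h₂
  have hjd : MDifferentiable (𝓡 (n + 1)) (𝓡 (n + 1)) j := hjs.mdifferentiable (by simp)
  have hkd : MDifferentiable (𝓡 (n + 1)) (𝓡 (n + 1)) k := hks.mdifferentiable (by simp)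
  set ji : 𝒟₁.carrier → 𝒰.carrier := invFun j with hji_def
  have hleft : ∀ x, ji (j x) = x := leftInverse_invFun hjo.injective
  have hright : ∀ p ∈ range j, j (ji p) = p := fun p hp ↦ invFun_eq hp
  have hjis : ContMDiffOn (𝓡 (n + 1)) (𝓡 (n + 1)) ∞ ji (range j) :=
    contMDiffOn_invFun_range (𝒮 := 𝒰.toSpacetime) (𝒮' := 𝒟₁.toSpacetime) hji hjo.injective
  have hjid : ∀ p ∈ range j, MDifferentiableAt (𝓡 (n + 1)) (𝓡 (n + 1)) ji p := fun p hp ↦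
    ((hjis p hp).contMDiffAt (hjo.isOpen_range.mem_nhds hp)).mdifferentiableAt (by simp)
  -- `dj (dj⁻¹ w) = w` on the range
  have hdd : ∀ (x : 𝒰.carrier) (w : TangentSpace (𝓡 (n + 1)) (j x)),
      mfderiv (𝓡 (n + 1)) (𝓡 (n + 1)) j (ji (j x)) (mfderiv (𝓡 (n + 1)) (𝓡 (n + 1)) ji (j x) w)
        = w :=
    mfderiv_comp_mfderiv_invFun (𝒮 := 𝒰.toSpacetime) (𝒮' := 𝒟₁.toSpacetime) hji hjo.injective hjo
  -- scalar products: `g_𝒰 (dj⁻¹ v, dj⁻¹ w) = g₁ (v, w)` at points `j x`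
  have hval : ∀ (x : 𝒰.carrier) (v w : TangentSpace (𝓡 (n + 1)) (j x)),
      𝒰.metric.val (ji (j x)) (mfderiv (𝓡 (n + 1)) (𝓡 (n + 1)) ji (j x) v)
        (mfderiv (𝓡 (n + 1)) (𝓡 (n + 1)) ji (j x) w) = 𝒟₁.metric.val (j x) v w := by
    intro x v w
    have h := congrArg (fun b ↦ b (mfderiv (𝓡 (n + 1)) (𝓡 (n + 1)) ji (j x) v)
      (mfderiv (𝓡 (n + 1)) (𝓡 (n + 1)) ji (j x) w)) (hji.2 (ji (j x)))
    simp only [pullbackBilin_apply] at h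
    rw [hdd, hdd] at h
    -- `h : g₁ (j (ji (j x))) v w = g_𝒰 …`; the base point `j (ji (j x)) = j x`
    rw [hleft] at h ⊢
    exact h.symm
  -- future-directed vectors: `dj⁻¹ v` is future-directed if `v` is (converse timecone lemma)
  have hfut : ∀ (x : 𝒰.carrier) (v : TangentSpace (𝓡 (n + 1)) (j x)),
      𝒟₁.timeOrientation.IsFutureDirected v →
        𝒰.timeOrientation.IsFutureDirected (mfderiv (𝓡 (n + 1)) (𝓡 (n + 1)) ji (j x) v) := by
    intro x v hv
    refine hjt.isFutureDirected_of_mfderiv hji.2 ?_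
    rw [hdd]
    rw [hleft]
    exact hv
  refine ⟨⟨range j, hjo.isOpen_range⟩, k ∘ ji, fun u ↦ ?_, ?_, ?_, ?_, ?_, ?_, ?_⟩
  · -- `ι₁ u = j (ι_𝒰 u) ∈ range j`
    exact ⟨𝒰.embed u, congrFun hjc u⟩
  · -- connected
    exact isConnected_range hjs.continuous
  · -- `ι₁(N)` is a Cauchy hypersurface of the sub-spacetime `range j`
    intro γ s hγ
    obtain ⟨hs, hγt, hγf, hγp⟩ := hγ
    have hγM : 𝒟₁.metric.IsFutureTimelikeCurveOn 𝒟₁.timeOrientation (Subtype.val ∘ γ) s :=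
      (LorentzianMetric.isFutureTimelikeCurveOn_restrict_iff 𝒟₁.metric 𝒟₁.timeOrientation
        PseudoRiemannianMetric.contMDiff_restrict_holds
        𝒟₁.timeOrientation.contMDiff_restrict_holds _).1 hγt
    -- the pulled-back curve in `𝒰`
    set δ : ℝ → 𝒰.carrier := fun t ↦ ji (γ t : 𝒟₁.carrier) with hδ_def
    have hjδ : ∀ t, j (δ t) = (γ t : 𝒟₁.carrier) := fun t ↦ hright _ (γ t).2
    have hδt : 𝒰.metric.IsFutureTimelikeCurveOn 𝒰.timeOrientation δ s := by
      intro t ht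
      obtain ⟨hd, h1, h2⟩ := hγM t ht
      obtain ⟨x, hx⟩ := (γ t).2
      have hdδ : HasMFDerivAt 𝓘(ℝ, ℝ) (𝓡 (n + 1)) δ t
          ((mfderiv (𝓡 (n + 1)) (𝓡 (n + 1)) ji (γ t : 𝒟₁.carrier)).comp
            (mfderiv 𝓘(ℝ, ℝ) (𝓡 (n + 1)) (Subtype.val ∘ γ) t)) :=
        (hjid _ (γ t).2).hasMFDerivAt.comp t hd.hasMFDerivAt
      have hvel : velocity (𝓡 (n + 1)) δ t =
          mfderiv (𝓡 (n + 1)) (𝓡 (n + 1)) ji (γ t : 𝒟₁.carrier)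
            (velocity (𝓡 (n + 1)) (Subtype.val ∘ γ) t) := by
        simp only [velocity]; rw [hdδ.mfderiv]; rfl
      refine ⟨hdδ.mdifferentiableAt, ?_, ?_⟩
      · -- timelike
        change 𝒰.metric.val (δ t) (velocity (𝓡 (n + 1)) δ t) (velocity (𝓡 (n + 1)) δ t) < 0
        rw [hvel]
        have hv := hval x
        rw [hx] at hv
        rw [show δ t = ji (γ t : 𝒟₁.carrier) from rfl, hv]
        exact h1
      · -- future-directed
        rw [hvel]
        have hf := hfut x
        rw [hx] at hf
        exact hf _ h2
    have hcontδ : ∀ t ∈ s, ContinuousAt δ t := fun t ht ↦ (hδt t ht).1.continuousAt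
    -- endlessness transported along the homeomorphism `j : 𝒰 ≅ range j`
    have hδf : IsFutureEndless δ s := by
      refine ⟨hγf.1, fun q hq ↦ hγf.2 ⟨j q, q, rfl⟩ ?_⟩
      have h1 : HasFutureEndpoint (j ∘ δ) s (j q) := (hjs.continuous.tendsto q).comp hq
      have h2 : HasFutureEndpoint (Subtype.val ∘ γ) s (j q) := h1.congr fun t ↦ hjδ t
      exact hasFutureEndpoint_subtypeVal_comp_iff.1 h2
    have hδp : IsPastEndless δ s := by
      refine ⟨hγp.1, fun q hq ↦ hγp.2 ⟨j q, q, rfl⟩ ?_⟩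
      have h1 : HasPastEndpoint (j ∘ δ) s (j q) := (hjs.continuous.tendsto q).comp hq
      have h2 : HasPastEndpoint (Subtype.val ∘ γ) s (j q) := h1.congr fun t ↦ hjδ t
      exact hasPastEndpoint_subtypeVal_comp_iff.1 h2
    -- `δ` meets `ι_𝒰(N)` exactly once; crossings correspond
    obtain ⟨t₀, ⟨ht₀s, u₀, hu₀⟩, huniq⟩ := 𝒰.isCauchyHypersurface δ s ⟨hs, hδt, hδf, hδp⟩
    refine ⟨t₀, ⟨ht₀s, u₀, ?_⟩, fun t ht ↦ huniq t ⟨ht.1, ?_⟩⟩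
    · -- `γ t₀ = j (δ t₀) = j (ι_𝒰 u₀) = ι₁ u₀`
      show 𝒟₁.embed u₀ = (γ t₀ : 𝒟₁.carrier)
      rw [← hjδ t₀, ← hu₀]; exact (congrFun hjc u₀).symm
    · obtain ⟨u, hu⟩ := ht.2
      refine ⟨u, ?_⟩
      show 𝒰.embed u = ji (γ t : 𝒟₁.carrier)
      rw [← hu, show 𝒟₁.embed u = j (𝒰.embed u) from (congrFun hjc u).symm, hleft]
  · -- smooth on `range j`
    exact hks.comp_contMDiffOn hjis
  · -- isometric on `range j`
    rintro _ ⟨x, rfl⟩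
    ext v w
    have hc := mfderiv_comp (j x) (hkd (ji (j x))) (hjid (j x) ⟨x, rfl⟩)
    have hk := congrArg (fun b ↦ b (mfderiv (𝓡 (n + 1)) (𝓡 (n + 1)) ji (j x) v)
      (mfderiv (𝓡 (n + 1)) (𝓡 (n + 1)) ji (j x) w)) (hki.2 (ji (j x)))
    simp only [pullbackBilin_apply] at hk ⊢
    rw [hc]
    exact hk.trans (hval x v w)
  · -- time-orientation preserving on `range j`
    rintro _ ⟨x, rfl⟩
    rw [mfderiv_comp (j x) (hkd (ji (j x))) (hjid (j x) ⟨x, rfl⟩)]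
    exact hkt.isFutureDirected_mfderiv hki.2
      (hfut x _ (𝒟₁.timeOrientation.isFutureDirected_vectorField (j x)))
  · -- `(k ∘ j⁻¹) ∘ ι₁ = k ∘ ι_𝒰 = ι₂`
    funext u
    show k (ji (𝒟₁.embed u)) = 𝒟₂.embed u
    rw [show 𝒟₁.embed u = j (𝒰.embed u) from (congrFun hjc u).symm, hleft]
    exact congrFun hkc u

end SubdataDevelopmentsEmbed

end Summit.FinalStateConjecture.FinalStateConjecture.Theorems

end
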